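import Mathlib
import Literature.Probability.Percolation.PercolationProofs
import Literature.Probability.LatticeModels.ProdBernoulliIndependence
import Literature.Probability.LatticeModels.ProdBernoulliClusterLocality
import Literature.Probability.Percolation.KozmaNitzanPinning
import Summits.CriticalPhenomena.PercolationContinuityZ3.Theorems.PercNearOneGluingAdditiveGluingSigmaRecursion
import Summits.CriticalPhenomena.PercolationContinuityZ3.Theorems.PercNearOneGluingAdditiveGluingGoodBase
import Summits.CriticalPhenomena.PercolationContinuityZ3.Theorems.PercNearOneGluingAdditiveGluingLemma5AnyRelay
import HarnessLib

/-! # Crux `PercNearOneGluing.AdditiveGluing` (stmt-CriticalPhenomena-4576), line `subuniform-dead-pocket-maximum` —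
# `stub_goodStep` with a unique low neighbour (KN Theorem 5): toolkit, and the live/dead partition

Helper file (siege on `stub_goodStep`, attempt k20; `--supports stmt-CriticalPhenomena-4576`; proves the
registered partial-result stub `stub_goodStepLiveDeadPartition`).  Toolkit for the formalisation of
Kozma–Nitzan arXiv:2401.12397 Theorem 5 in the stub vocabulary (main file `…GoodStepUniqueLow.lean`):
rerouting of open paths around a vertex `o` whose open star is the single pair `o–x`; the resulting
identities on KN's fibre `σ_x = {ω | ∀ y ≠ o, o–y open ↔ y = x}` (`σ_x ∩ {a ↔ b} = σ_x ∩ {a ↔ b in {o}ᶜ}`,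
`σ_x ∩ {o ↔ b} = σ_x ∩ {x ↔ b in {o}ᶜ}`, "on `σ_x`, `C(o) = insert o (vertices joined to x off o)`");
determination by the pairs off `o`, independence from the open star; the comparison of a weighting
`w'` KILLED at `o` (equal to `w` off `o`, zero on the star) with `w`; termwise KN Lemma 5 on the fibres
`B ∉ {∅, {x}}`; and the LIVE/DEAD PARTITION `μ(o ↔ A) + Σ_{W ∋ o, W ∩ A = ∅} μ(C(o) = W) = 1` (whence the
skeleton's selection form of goodness is KN's form).  All folklore / KN p. 14; no new definitions. -/

namespace Summit.CriticalPhenomena.PercolationContinuityZ3.Theorems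

open MeasureTheory Set
open Literature.Probability.LatticeModels (prodBernoulli prodBernoulli_real_inter_of_determinedBy
  prodBernoulli_real_eq_of_determinedBy)
open Literature.Probability.Percolation (BondConfig openConn openConnIn openGraph openCluster
  openGraph_adj DeterminedBy determinedBy_iff PathIn openConnIn_subset_openConn mem_openCluster_self)
open Literature.Probability.Percolation.DCT16 (mem_openConnIn_of_pathIn pathIn_of_mem_openConnIn
  reachable_of_pathIn mem_openConnIn_iff_pathIn determinedBy_openConnIn)
open scoped BigOperators

noncomputable section
open Classical

variable {n : ℕ}

/-! ### Paths around a vertex whose open star is a single pair -/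

/-- If every neighbour of `o` is `x`, a walk between two vertices other than `o` can be rerouted
inside `{o}ᶜ` (each visit of `o` is a detour `x – o – x`). [folklore] -/
theorem goodStepU_pathIn_of_star {V : Type*} {G : SimpleGraph V} {o x a z : V}
    (hstar : ∀ y, G.Adj o y → y = x) (ha : a ≠ o) (hz : z ≠ o) (h : G.Reachable a z) :
    PathIn G ({o}ᶜ : Set V) a z := by
  rw [SimpleGraph.reachable_iff_reflTransGen] at h
  suffices key : ∀ y, Relation.ReflTransGen G.Adj a y →
      (y ≠ o → PathIn G ({o}ᶜ : Set V) a y) ∧ (y = o → PathIn G ({o}ᶜ : Set V) a x) from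
    (key z h).1 hz
  intro y hy
  induction hy with
  | refl => exact ⟨fun _ => PathIn.refl (Set.mem_compl_singleton_iff.2 ha), fun h => absurd h ha⟩
  | @tail p q _ hpq ih =>
    refine ⟨fun hq => ?_, fun hq => ?_⟩
    · by_cases hp : p = o
      · subst hp
        have hqx : q = x := hstar q hpq
        subst hqx
        exact ih.2 rfl
      · exact (ih.1 hp).tail hpq (Set.mem_compl_singleton_iff.2 hq)
    · subst hq
      have hpx : p = x := hstar p hpq.symm
      subst hpx
      exact ih.1 hpq.ne

/-- If every neighbour of `o` is `x ≠ o`, a vertex `z ≠ o` reachable from `o` is reachable from `x`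
inside `{o}ᶜ`. [folklore] -/
theorem goodStepU_pathIn_of_star_self {V : Type*} {G : SimpleGraph V} {o x z : V}
    (hstar : ∀ y, G.Adj o y → y = x) (hxo : x ≠ o) (hz : z ≠ o) (h : G.Reachable o z) :
    PathIn G ({o}ᶜ : Set V) x z := by
  rw [SimpleGraph.reachable_iff_reflTransGen] at h
  rcases Relation.ReflTransGen.cases_head h with h | ⟨c, hoc, hcz⟩
  · exact absurd h.symm hz
  · have hcx : c = x := hstar c hoc
    subst hcx
    exact goodStepU_pathIn_of_star hstar hxo hz
      ((SimpleGraph.reachable_iff_reflTransGen _ _).2 hcz)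

/-- A path inside `S` along which no edge ends at `o` is a path inside `S ∩ {o}ᶜ` (when it starts
off `o`). [folklore] -/
theorem goodStepU_pathIn_inter_compl {V : Type*} {G : SimpleGraph V} {S : Set V} {o u v : V}
    (hu : u ≠ o) (hstep : ∀ p q, G.Adj p q → q ≠ o) (h : PathIn G S u v) :
    PathIn G (S ∩ {o}ᶜ) u v := by
  obtain ⟨huS, h⟩ := h
  refine ⟨⟨huS, Set.mem_compl_singleton_iff.2 hu⟩, ?_⟩
  induction h with
  | refl => exact Relation.ReflTransGen.refl
  | tail _ hbc ih => exact ih.tail ⟨hbc.1, hbc.2, Set.mem_compl_singleton_iff.2 (hstep _ _ hbc.1)⟩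

/-! ### The fibre `σ_x` of the open star: set identities -/

/-- On `σ_x` (the only open non-loop pair at `o` is `o–x`), every open neighbour of `o` is `x`. -/
theorem goodStepU_star_of_sigma {ω : BondConfig (Fin n)} {o x : Fin n}
    (hω : ∀ y : Fin n, y ≠ o → (s(o, y) ∈ ω ↔ y ∈ ({x} : Finset (Fin n)))) :
    ∀ y, (openGraph ω).Adj o y → y = x := by
  intro y hy
  rw [openGraph_adj] at hy
  exact Finset.mem_singleton.1 ((hω y (fun h => hy.2 h.symm)).1 hy.1)

/-- On `σ_x`, for `a, b ≠ o`: `a ↔ b` iff `a ↔ b in {o}ᶜ`. -/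
theorem goodStepU_sigma_inter_openConn (o x a b : Fin n) (ha : a ≠ o) (hb : b ≠ o) :
    {ω : BondConfig (Fin n) | ∀ y : Fin n, y ≠ o → (s(o, y) ∈ ω ↔ y ∈ ({x} : Finset (Fin n)))}
        ∩ openConn a b =
      {ω : BondConfig (Fin n) | ∀ y : Fin n, y ≠ o → (s(o, y) ∈ ω ↔ y ∈ ({x} : Finset (Fin n)))}
        ∩ openConnIn (({o} : Set (Fin n))ᶜ) a b := by
  ext ω
  simp only [Set.mem_inter_iff, Set.mem_setOf_eq]
  refine ⟨fun h => ⟨h.1, ?_⟩, fun h => ⟨h.1, openConnIn_subset_openConn _ a b h.2⟩⟩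
  exact mem_openConnIn_of_pathIn (goodStepU_pathIn_of_star (goodStepU_star_of_sigma h.1) ha hb h.2)

/-- On `σ_x` with `x ≠ o`, a vertex `y ≠ o` is joined to `o` iff it is joined to `x` off `o`. -/
theorem goodStepU_sigma_reachable_iff {ω : BondConfig (Fin n)} {o x y : Fin n}
    (hσ : ∀ y : Fin n, y ≠ o → (s(o, y) ∈ ω ↔ y ∈ ({x} : Finset (Fin n)))) (hxo : x ≠ o) (hy : y ≠ o) :
    (openGraph ω).Reachable o y ↔ ω ∈ openConnIn (({o} : Set (Fin n))ᶜ) x y := by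
  refine ⟨fun h => mem_openConnIn_of_pathIn
    (goodStepU_pathIn_of_star_self (goodStepU_star_of_sigma hσ) hxo hy h), fun h => ?_⟩
  have hox : (openGraph ω).Adj o x :=
    (openGraph_adj ω o x).2 ⟨(hσ x hxo).2 (Finset.mem_singleton_self x), fun h' => hxo h'.symm⟩
  exact hox.reachable.trans (reachable_of_pathIn (pathIn_of_mem_openConnIn h))

/-- On `σ_x` with `x ≠ o`, for `b ≠ o`: `o ↔ b` iff `x ↔ b in {o}ᶜ`. -/
theorem goodStepU_sigma_inter_openConn_self (o x b : Fin n) (hxo : x ≠ o) (hb : b ≠ o) :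
    {ω : BondConfig (Fin n) | ∀ y : Fin n, y ≠ o → (s(o, y) ∈ ω ↔ y ∈ ({x} : Finset (Fin n)))}
        ∩ openConn o b =
      {ω : BondConfig (Fin n) | ∀ y : Fin n, y ≠ o → (s(o, y) ∈ ω ↔ y ∈ ({x} : Finset (Fin n)))}
        ∩ openConnIn (({o} : Set (Fin n))ᶜ) x b := by
  ext ω
  simp only [Set.mem_inter_iff, Set.mem_setOf_eq]
  exact ⟨fun h => ⟨h.1, (goodStepU_sigma_reachable_iff h.1 hxo hb).1 h.2⟩,
    fun h => ⟨h.1, (goodStepU_sigma_reachable_iff h.1 hxo hb).2 h.2⟩⟩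

/-- On `σ_x` with `x ≠ o`: if `W'` is exactly the set of vertices joined to `x` off `o`, then
`C(o) = insert o W'`. -/
theorem goodStepU_sigma_inter_offCluster_subset (o x : Fin n) (hxo : x ≠ o) (W' : Finset (Fin n)) :
    {ω : BondConfig (Fin n) | ∀ y : Fin n, y ≠ o → (s(o, y) ∈ ω ↔ y ∈ ({x} : Finset (Fin n)))}
        ∩ {ω | ∀ y : Fin n, y ∈ W' ↔ ω ∈ openConnIn (({o} : Set (Fin n))ᶜ) x y} ⊆
      {ω : BondConfig (Fin n) | openCluster ω o = ((insert o W' : Finset (Fin n)) : Set (Fin n))} := by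
  rintro ω ⟨hσ, hF⟩
  simp only [Set.mem_setOf_eq] at hσ hF ⊢
  ext y
  rw [Finset.coe_insert, Set.mem_insert_iff, Finset.mem_coe]
  change (openGraph ω).Reachable o y ↔ _
  by_cases hy : y = o
  · subst hy
    simp
  · rw [hF y, goodStepU_sigma_reachable_iff hσ hxo hy]
    exact ⟨Or.inr, fun h => h.resolve_left hy⟩

/-- `σ_∅ ⊆ {C(o) = {o}}` (converse of `goodBase_cluster_singleton_subset`). [folklore] -/
theorem goodStepU_isolated_subset_cluster_singleton (o : Fin n) :
    {ω : BondConfig (Fin n) | ∀ y : Fin n, y ≠ o → s(o, y) ∉ ω} ⊆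
      {ω : BondConfig (Fin n) | openCluster ω o = ((({o} : Finset (Fin n))) : Set (Fin n))} := by
  intro ω hω
  simp only [Set.mem_setOf_eq] at hω ⊢
  rw [Finset.coe_singleton]
  refine Set.Subset.antisymm (fun y (h : (openGraph ω).Reachable o y) => ?_) ?_
  · by_contra hy
    obtain ⟨z, hzo, hz, -⟩ := goodBase_exists_open_pair h hy
    exact hω z hzo hz
  · rintro y rfl
    exact mem_openCluster_self ω y

/-! ### Determination by pairs off `o`, independence from the open star, agreement of weights -/

/-- The pairs inside `{o}ᶜ` avoid the star of `o`. -/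
theorem goodStepU_sym2_compl_subset (o : Fin n) :
    (({o} : Set (Fin n))ᶜ).sym2 ⊆ (↑(Finset.univ.filter fun e : Sym2 (Fin n) => o ∈ e) : Set (Sym2 (Fin n)))ᶜ := by
  intro e he
  rw [Set.mem_compl_iff, Finset.coe_filter]
  rintro ⟨-, hoe⟩
  exact Set.mem_sym2_iff_subset.1 he hoe rfl

/-- The fibre event `σ_B` is determined by the pairs containing `o`. [folklore] -/
theorem goodStepU_determinedBy_sigma (o : Fin n) (B : Finset (Fin n)) :
    DeterminedBy {ω : BondConfig (Fin n) | ∀ y : Fin n, y ≠ o → (s(o, y) ∈ ω ↔ y ∈ B)}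
      (↑(Finset.univ.filter fun e : Sym2 (Fin n) => o ∈ e) : Set (Sym2 (Fin n))) := by
  rw [determinedBy_iff]
  intro ω ω' h
  simp only [Set.mem_setOf_eq]
  refine forall₂_congr fun y _ => ?_
  have he : s(o, y) ∈ (↑(Finset.univ.filter fun e : Sym2 (Fin n) => o ∈ e) : Set (Sym2 (Fin n))) := by
    rw [Finset.coe_filter]
    exact ⟨Finset.mem_univ _, Sym2.mem_mk_left o y⟩
  rw [show (s(o, y) ∈ ω ↔ s(o, y) ∈ ω') from
    ⟨fun h1 => ((Set.ext_iff.1 h _).1 ⟨h1, he⟩).1, fun h1 => ((Set.ext_iff.1 h _).2 ⟨h1, he⟩).1⟩]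

/-- The event "`W'` is exactly the set of vertices joined to `x` off `o`" is determined by any set of
pairs containing the pairs inside `{o}ᶜ`. [folklore] -/
theorem goodStepU_determinedBy_offCluster (o x : Fin n) (W' : Finset (Fin n)) {K : Set (Sym2 (Fin n))}
    (hK : (({o} : Set (Fin n))ᶜ).sym2 ⊆ K) :
    DeterminedBy {ω : BondConfig (Fin n) | ∀ y : Fin n, y ∈ W' ↔ ω ∈ openConnIn (({o} : Set (Fin n))ᶜ) x y} K := by
  rw [determinedBy_iff]
  intro ω ω' h
  simp only [Set.mem_setOf_eq]
  refine forall_congr' fun y => ?_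
  have hd := (determinedBy_iff _ _).1
    (determinedBy_openConnIn (({o} : Set (Fin n))ᶜ) x y hK) ω ω' h
  rw [hd]

/-- **Independence from the open star**: for an event `X` determined by the pairs off the star of `o`,
`μ(σ_B ∩ X) = μ(σ_B) · μ(X)`. [folklore] -/
theorem goodStepU_real_sigma_inter (w : Sym2 (Fin n) → unitInterval) (o : Fin n) (B : Finset (Fin n))
    {X : Set (BondConfig (Fin n))}
    (hX : DeterminedBy X (↑(Finset.univ.filter fun e : Sym2 (Fin n) => o ∈ e) : Set (Sym2 (Fin n)))ᶜ) :
    (prodBernoulli w).real ({ω : BondConfig (Fin n) | ∀ y : Fin n, y ≠ o → (s(o, y) ∈ ω ↔ y ∈ B)} ∩ X) =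
      (prodBernoulli w).real {ω : BondConfig (Fin n) | ∀ y : Fin n, y ≠ o → (s(o, y) ∈ ω ↔ y ∈ B)} *
        (prodBernoulli w).real X :=
  prodBernoulli_real_inter_of_determinedBy w
    (Finset.univ.filter fun e : Sym2 (Fin n) => o ∈ e) (goodStepU_determinedBy_sigma o B) hX
    (Set.toFinite _).measurableSet (Set.toFinite _).measurableSet

/-- Under a weighting vanishing on every pair `o–y`, `y ≠ o`, the open star of `o` is a.s. empty:
`μ'({∃ y ≠ o, o–y open}) = 0`. [folklore] -/
theorem goodStepU_real_star_open_eq_zero (w' : Sym2 (Fin n) → unitInterval) (o : Fin n)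
    (h2 : ∀ y : Fin n, y ≠ o → w' s(o, y) = 0) :
    (prodBernoulli w').real {ω : BondConfig (Fin n) | ∀ y : Fin n, y ≠ o → s(o, y) ∉ ω}ᶜ = 0 := by
  refine sigmaRec_null w' _ ((Finset.univ.filter fun y : Fin n => y ≠ o).image fun y => s(o, y)) ?_ ?_
  · intro e he
    obtain ⟨y, hy, rfl⟩ := Finset.mem_image.1 he
    exact h2 y (Finset.mem_filter.1 hy).2
  · intro ω hω
    rw [Set.mem_compl_iff, Set.mem_setOf_eq] at hω
    push Not at hω
    obtain ⟨y, hyo, hy⟩ := hω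
    exact ⟨s(o, y), Finset.mem_image.2 ⟨y, Finset.mem_filter.2 ⟨Finset.mem_univ _, hyo⟩, rfl⟩, hy⟩

/-- With the star of `o` closed, no open edge ends at `o`. [folklore] -/
theorem goodStepU_step_of_isolated {ω : BondConfig (Fin n)} {o : Fin n}
    (hω : ∀ y : Fin n, y ≠ o → s(o, y) ∉ ω) : ∀ p q, (openGraph ω).Adj p q → q ≠ o := by
  intro p q hpq hq
  rw [openGraph_adj, hq, Sym2.eq_swap] at hpq
  exact hω p hpq.2 hpq.1

/-- Under a weighting vanishing on the star of `o`, an inclusion valid when the star is closed gives an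
inequality of probabilities. [folklore] -/
theorem goodStepU_real_le_of_isolated (w' : Sym2 (Fin n) → unitInterval) (o : Fin n)
    (h2 : ∀ y : Fin n, y ≠ o → w' s(o, y) = 0) {S T : Set (BondConfig (Fin n))}
    (hST : ∀ ω ∈ S, (∀ y : Fin n, y ≠ o → s(o, y) ∉ ω) → ω ∈ T) :
    (prodBernoulli w').real S ≤ (prodBernoulli w').real T :=
  calc (prodBernoulli w').real S
      ≤ (prodBernoulli w').real (T ∪ {ω : BondConfig (Fin n) | ∀ y : Fin n, y ≠ o → s(o, y) ∉ ω}ᶜ) :=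
        measureReal_mono fun ω hω => by
          by_cases hz : ω ∈ {ω : BondConfig (Fin n) | ∀ y : Fin n, y ≠ o → s(o, y) ∉ ω}
          · exact Or.inl (hST ω hω hz)
          · exact Or.inr hz
    _ ≤ (prodBernoulli w').real T +
          (prodBernoulli w').real {ω : BondConfig (Fin n) | ∀ y : Fin n, y ≠ o → s(o, y) ∉ ω}ᶜ :=
        measureReal_union_le _ _
    _ = (prodBernoulli w').real T := by rw [goodStepU_real_star_open_eq_zero w' o h2, add_zero]

/-- **Killing the star is deleting `o`, for the pockets of `x`**: if `w'` agrees with `w` off `o` and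
vanishes on the star of `o`, then for `x ≠ o` the `μ'`-probability that `C(x) = W'` is at most the
`μ`-probability that `W'` is exactly the set of vertices joined to `x` off `o`. [folklore] -/
theorem goodStepU_real_cluster_le_offCluster (w w' : Sym2 (Fin n) → unitInterval) (o x : Fin n)
    (hxo : x ≠ o) (h1 : ∀ e ∈ (({o} : Set (Fin n))ᶜ).sym2, w e = w' e)
    (h2 : ∀ y : Fin n, y ≠ o → w' s(o, y) = 0) (W' : Finset (Fin n)) :
    (prodBernoulli w').real {ω : BondConfig (Fin n) | openCluster ω x = (W' : Set (Fin n))} ≤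
      (prodBernoulli w).real
        {ω : BondConfig (Fin n) | ∀ y : Fin n, y ∈ W' ↔ ω ∈ openConnIn (({o} : Set (Fin n))ᶜ) x y} := by
  rw [prodBernoulli_real_eq_of_determinedBy w w' h1 (goodStepU_determinedBy_offCluster o x W' subset_rfl)
    (Set.toFinite _).measurableSet]
  refine goodStepU_real_le_of_isolated w' o h2 fun ω hω hz y => ?_
  have hω' : openCluster ω x = (W' : Set (Fin n)) := hω
  rw [← Finset.mem_coe, ← hω', mem_openConnIn_iff_pathIn]
  exact ⟨fun h => lemma5AnyRelay_pathIn_compl hxo (goodStepU_step_of_isolated hz) h, reachable_of_pathIn⟩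

/-- **Killing the star is deleting `o`, for connections avoiding a pocket**: for `s ≠ o`,
`μ'(s ↔ b in W'ᶜ) ≤ μ(s ↔ b in W'ᶜ ∩ {o}ᶜ)`. [folklore] -/
theorem goodStepU_real_openConnIn_le (w w' : Sym2 (Fin n) → unitInterval) (o s b : Fin n)
    (hs : s ≠ o) (h1 : ∀ e ∈ (({o} : Set (Fin n))ᶜ).sym2, w e = w' e)
    (h2 : ∀ y : Fin n, y ≠ o → w' s(o, y) = 0) (W' : Finset (Fin n)) :
    (prodBernoulli w').real (openConnIn ((W' : Set (Fin n))ᶜ) s b) ≤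
      (prodBernoulli w).real (openConnIn ((W' : Set (Fin n))ᶜ ∩ ({o} : Set (Fin n))ᶜ) s b) := by
  have hK : (((W' : Set (Fin n))ᶜ ∩ ({o} : Set (Fin n))ᶜ)).sym2 ⊆ (({o} : Set (Fin n))ᶜ).sym2 :=
    fun e he => Set.mem_sym2_iff_subset.2 fun z hz => (Set.mem_sym2_iff_subset.1 he hz).2
  rw [prodBernoulli_real_eq_of_determinedBy w w' h1 (determinedBy_openConnIn _ s b hK)
    (Set.toFinite _).measurableSet]
  exact goodStepU_real_le_of_isolated w' o h2 fun ω hω hz => mem_openConnIn_of_pathIn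
    (goodStepU_pathIn_inter_compl hs (goodStepU_step_of_isolated hz) (pathIn_of_mem_openConnIn hω))

/-! ### The fibres of the open star of `o` -/

/-- **Termwise Lemma 5 off the two exceptional fibres.**  For a fibre `B ∉ {∅, {x}}` of the open
star of `o` and the `τ°`-minimiser `a₀` over `A`: `μ(σ_B ∩ {a₀ ↔ b}) ≤ μ(σ_B ∩ {o ↔ b})` — KN
Lemma 5 (`stub_lemma5AnyRelay`) if `B` meets `A`; otherwise `B` contains a vertex `y ∉ A ∪ {x}`,
whose pair `o–y` has weight `0`, and `σ_B` is null (fibres over `B ∋ o` are empty).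
(Kozma–Nitzan arXiv:2401.12397, proof of Thm 5 p. 14, first case.) -/
theorem goodStepU_term_le (w : Sym2 (Fin n) → unitInterval) (A B : Finset (Fin n)) (o b x a₀ : Fin n)
    (hbo : b ≠ o) (ha₀o : a₀ ≠ o)
    (hmin : ∀ v ∈ A, (prodBernoulli w).real (openConnIn (({o} : Set (Fin n))ᶜ) a₀ b)
      ≤ (prodBernoulli w).real (openConnIn (({o} : Set (Fin n))ᶜ) v b))
    (huniq : ∀ y : Fin n, y ∉ A → y ≠ o → y ≠ x → w s(o, y) = 0) (hB : B ≠ ∅) (hBx : B ≠ {x}) :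
    (prodBernoulli w).real
        ((fun ω : BondConfig (Fin n) => Finset.univ.filter fun y : Fin n => y ≠ o ∧ s(o, y) ∈ ω) ⁻¹' {B}
          ∩ openConn a₀ b) ≤
      (prodBernoulli w).real
        ((fun ω : BondConfig (Fin n) => Finset.univ.filter fun y : Fin n => y ≠ o ∧ s(o, y) ∈ ω) ⁻¹' {B}
          ∩ openConn o b) := by
  by_cases hoB : o ∈ B
  · simp [goodBase_fibre_eq_empty o B hoB]
  rw [goodBase_fibre_eq o B hoB]
  by_cases hBA : (B ∩ A).Nonempty
  · obtain ⟨v, hv⟩ := hBA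
    exact stub_lemma5AnyRelay n w o b a₀ v B hbo ha₀o hoB (Finset.mem_inter.1 hv).1
      (hmin v (Finset.mem_inter.1 hv).2)
  · obtain ⟨y, hyB, hyx⟩ : ∃ y ∈ B, y ≠ x := by
      by_contra hcon
      push Not at hcon
      exact hBx (Finset.eq_singleton_iff_nonempty_unique_mem.2 ⟨Finset.nonempty_iff_ne_empty.2 hB, hcon⟩)
    have hyA : y ∉ A := fun h => hBA ⟨y, Finset.mem_inter.2 ⟨hyB, h⟩⟩
    have hyo : y ≠ o := fun h => hoB (h ▸ hyB)
    have hnull : (prodBernoulli w).real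
        {ω : BondConfig (Fin n) | ∀ y : Fin n, y ≠ o → (s(o, y) ∈ ω ↔ y ∈ B)} = 0 :=
      sigmaRec_null w _ {s(o, y)} (fun e he => by rw [Finset.mem_singleton.1 he]; exact huniq y hyA hyo hyx)
        fun ω hω => ⟨s(o, y), Finset.mem_singleton_self _, (hω y hyo).2 hyB⟩
    rw [measureReal_mono_null Set.inter_subset_left hnull]
    exact measureReal_nonneg

/-- Summation bookkeeping: compare two sums over all `B` termwise off `B ∈ {∅, {x}}`. [folklore] -/
theorem goodStepU_sum_le (g₁ g₂ : Finset (Fin n) → ℝ) (x : Fin n) (hnn : 0 ≤ g₂ ∅)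
    (hB : ∀ B : Finset (Fin n), B ≠ ∅ → B ≠ {x} → g₁ B ≤ g₂ B) :
    ∑ B, g₁ B ≤ ∑ B, g₂ B + g₁ ∅ + (g₁ {x} - g₂ {x}) := by
  have hx : ({x} : Finset (Fin n)) ∈ (Finset.univ : Finset (Finset (Fin n))).erase ∅ :=
    Finset.mem_erase.2 ⟨Finset.singleton_ne_empty x, Finset.mem_univ _⟩
  rw [← Finset.add_sum_erase _ g₁ (Finset.mem_univ ∅), ← Finset.add_sum_erase _ g₂ (Finset.mem_univ ∅),
    ← Finset.add_sum_erase _ g₁ hx, ← Finset.add_sum_erase _ g₂ hx]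
  have h : ∑ B ∈ ((Finset.univ : Finset (Finset (Fin n))).erase ∅).erase {x}, g₁ B ≤
      ∑ B ∈ ((Finset.univ : Finset (Finset (Fin n))).erase ∅).erase {x}, g₂ B :=
    Finset.sum_le_sum fun B hB' => hB B (Finset.ne_of_mem_erase (Finset.mem_of_mem_erase hB'))
      (Finset.ne_of_mem_erase hB')
  linarith

/-- Complement of an inserted finset, as a set. -/
theorem goodStepU_coe_insert_compl (o : Fin n) (W' : Finset (Fin n)) :
    ((insert o W' : Finset (Fin n)) : Set (Fin n))ᶜ = (W' : Set (Fin n))ᶜ ∩ ({o} : Set (Fin n))ᶜ := by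
  ext y
  simp [not_or, and_comm]

/-! ### The live/dead partition at an observer -/

/-- **Live part and dead pockets partition the space**: for any weighting, observer `o` and relay
set `A`, `μ(o ↔ A) + Σ_{W ∋ o, W ∩ A = ∅} μ(C(o) = W) = 1`. [folklore] -/
theorem stub_goodStepLiveDeadPartition : ∀ (n : ℕ) (p : Sym2 (Fin n) → unitInterval) (A : Finset (Fin n)) (o : Fin n),
    (prodBernoulli p).real (⋃ a ∈ A, (openConn o a : Set (BondConfig (Fin n)))) +
      ∑ W ∈ (Finset.univ : Finset (Finset (Fin n))).filter (fun W => o ∈ W ∧ Disjoint W A),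
        (prodBernoulli p).real {ω : BondConfig (Fin n) | openCluster ω o = (W : Set (Fin n))} = 1 := by
  intro n p A o
  set U : Set (BondConfig (Fin n)) := ⋃ a ∈ A, (openConn o a : Set (BondConfig (Fin n))) with hU
  let f : BondConfig (Fin n) → Finset (Fin n) := fun ω => (Set.toFinite (openCluster ω o)).toFinset
  have hfib : ∀ W : Finset (Fin n),
      f ⁻¹' {W} = {ω : BondConfig (Fin n) | openCluster ω o = (W : Set (Fin n))} := by
    intro W
    ext ω
    simp only [Set.mem_preimage, Set.mem_singleton_iff, Set.mem_setOf_eq, f]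
    rw [← Finset.coe_inj, Set.Finite.coe_toFinset]
  have hsum := sigmaRec_sum_preimage_inter p f Uᶜ
  have hUc : (prodBernoulli p).real Uᶜ = 1 - (prodBernoulli p).real U :=
    probReal_compl_eq_one_sub (Set.toFinite _).measurableSet
  have hterm : ∀ W : Finset (Fin n), (prodBernoulli p).real (f ⁻¹' {W} ∩ Uᶜ) =
      if o ∈ W ∧ Disjoint W A then
        (prodBernoulli p).real {ω : BondConfig (Fin n) | openCluster ω o = (W : Set (Fin n))} else 0 := by
    intro W
    rw [hfib W]
    split_ifs with hW
    · congr 1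
      ext ω
      simp only [Set.mem_inter_iff, Set.mem_setOf_eq, Set.mem_compl_iff, and_iff_left_iff_imp]
      intro hω hωU
      rw [hU, Set.mem_iUnion₂] at hωU
      obtain ⟨a, haA, hωa⟩ := hωU
      have haC : a ∈ openCluster ω o := hωa
      rw [hω, Finset.mem_coe] at haC
      exact Finset.disjoint_left.1 hW.2 haC haA
    · rw [show ({ω : BondConfig (Fin n) | openCluster ω o = (W : Set (Fin n))} ∩ Uᶜ) = ∅ from ?_,
        measureReal_empty]
      ext ω
      simp only [Set.mem_inter_iff, Set.mem_setOf_eq, Set.mem_compl_iff, Set.mem_empty_iff_false,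
        iff_false, not_and, not_not]
      intro hω
      have hoW : o ∈ W := by
        rw [← Finset.mem_coe, ← hω]
        exact mem_openCluster_self ω o
      have hWA : ¬ Disjoint W A := fun h => hW ⟨hoW, h⟩
      obtain ⟨a, haW, haA⟩ := Finset.not_disjoint_iff.1 hWA
      have haC : a ∈ openCluster ω o := by
        rw [hω]
        exact Finset.mem_coe.2 haW
      rw [hU]
      exact Set.mem_iUnion₂.2 ⟨a, haA, haC⟩
  simp_rw [hterm] at hsum
  rw [Finset.sum_ite, Finset.sum_const_zero, add_zero] at hsum
  linarith
end

end Summit.CriticalPhenomena.PercolationContinuityZ3.Theorems
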